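import Summits.QuantumFields.BalabanUV.Beta.RowD1FromBondLaws

/-!
# `BalabanUV.Beta.WardSiteToBlock` — binder row D1, hW side, «WX5»: **an1's SITE-LEVEL second-order Ward laws (W2-B) ∕ (W2-M) block-sum to the
# two bond-level Ward identities** `hWb` (WX4 ∕ RX `RowD1FromBondLaws`, border, at lockB `cB = −Lc¹²∕4`) and `hWM` (the row owner's K-W1 (WM-bond), mixed, at the
# Λ-lock `cΛ = 2∕Lc⁴`) (β sub-cell, D1 formalisation swarm, leaf-05 gen 7)

HONEST FRAMING (cell charter, verbatim): «discharging BetaPertH makes Balaban's UV stability UNCONDITIONAL — a real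
constructive-QFT result; it is NOT the continuum limit and NOT the Clay problem.»
HONEST DEPENDENCY: continuum YM on T⁴ ⇐ BetaPertH ∧ nine spine estimates (0/9 proved); BetaPertH ⇐ (D1) ∧ (D4) ∧ CAP+tail;
G-an2-4 gates asym, D1 and NE2/3/4.
DERIVED cell leaf ([folklore] finite-sum bookkeeping).  BOTH sides are hypothesis SHAPES: the site laws (W2-B) «`Σ_κ (Ssym_b(f;(κ,u−e_κ),h) −
Ssym_b(f;(κ,u),h)) = m_b(f,h)·([u = r_b] − [u = x_f])`» and (W2-M) «`Σ_κ (t_b(f,f′;(κ,u−e_κ)) − t_b(f,f′;(κ,u))) = 2·h_b(f,f′)·([u = r_b] − [u = x_f])`»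
(`r_b = Lc•y_b + ρ_c` the root; an1-g29 RESULT «W-WARD-TOY» (b), journal 2026-08-20, exact-ℚ toy 0 mismatches at D ≤ 2) are HYPOTHESES — the gauge
covariance of the rooted averaging, NOT theorems of the tree.  No statement of Bałaban's papers, no `[cite:]`, no definition, no `Prop` fact; proves
NO identity; 0∕4 binders (hW, hR, D1Tel, D1Rep).  NOT D1, NOT BetaPertH, NOT continuum, NOT Clay.

* **`bondWardB_of_siteWardB`**: (W2-B) ⟹ WX4's `hW` at `cB := −Lc¹²∕4` (the root indicator becomes `[z + ρ_c = y_v]` since `z = Lc•blk z` on the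
  coarse lattice; `stepScale 3 Lc 0 = 1`; the weight arithmetic `(Lc⁴)⁻¹·(−Lc¹²∕4) = ½·(−Lc⁴·½·Lc⁴)`).
* **`bondWardM_of_siteWardM`**: (W2-M) ⟹ K-W1's (WM-bond) at `cΛ := 2∕Lc⁴` (the root terms CANCEL in the f↔f′-symmetrisation by `hessKerAt_swap`;
  only the two row-leg indicators survive).
* **`symmetries_JsRowD1Pin_of_siteLaws`**: hW ∧ hR for `JsRowD1Pin hLc N` ⟸ the two reflection bond laws (MX4∕BX2 shapes) ∧ the two SITE Ward laws
  (RX `symmetries_JsRowD1Pin_of_bondLaws` composed with §1–§2).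
Provenance: β sub-cell, D1 formalisation swarm, unit b2b-balaban-beta-d1-formalise-leaf-05 gen 7, 2026-08-20 (v1); no existing file touched.
-/

open Finset
open scoped BigOperators
open Literature.MathematicalPhysics.QuantumFieldTheory
open Literature.MathematicalPhysics.QuantumFieldTheory.Balaban1983to89
open Literature.MathematicalPhysics.QuantumFieldTheory.Balaban1983to89.Beta
open ExpKernelCalculus (MKer)
open AffineAveraging (box toSite)
open AveragingContours (blk off)
open AveragingContoursRooted (ctrOff)
open AveragingHessianKernelsRooted (vhKerAt linKerAt hessKerAt hessKerAt_swap)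
open AveragingMixedJetTables (vh2KerAt mixKerAt)
open PolarizationSign (reflSign WardTransversal AxisReflectionCovariant)
open ResolventReflection (bref)
open RootedKernelReflection (eq_zsmul_blk_of_off)
open OneStepResolventKernel (Fib JetData)
open OneStepKernelFamily (TbalOf flipK D1Tel D1Rep D1Drift)
open Literature.MathematicalPhysics.QuantumFieldTheory.Balaban1983to89.Beta.VectorTailsLoc (fam kfam)
open Literature.MathematicalPhysics.QuantumFieldTheory.Balaban1983to89.Beta.VectorLegVolumeAdapter (MvE)
open B6BondElimination (unitVec)
open BalabanStepJetsSucc (wVH)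
open Summit.QuantumFields.BalabanUV.Beta.BorderedHessian (stepScale)
open Summit.QuantumFields.BalabanUV.Beta.RowD1JointEnd (JsRowD1Pin)
open Summit.QuantumFields.BalabanUV.Beta.RowD1FromBondLaws (symmetries_JsRowD1Pin_of_bondLaws)

namespace Summit.QuantumFields.BalabanUV.Beta.WardSiteToBlock

noncomputable section

variable {Lc : ℕ} [NeZero Lc]

/-- [folklore] **(W2-B) ⟹ THE BORDER WARD BOND IDENTITY `hWb` AT lockB** `cB = −Lc¹²∕4` (WX4's `hW` ∕ RX's `hWb`, token for token). -/
theorem bondWardB_of_siteWardB (hLc : Odd Lc)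
    (hS : ∀ (u : Fin 4 → ℤ) (m : Fin 4) (y : Fin 4 → ℤ) (β : Fin 4) (x : Fin 4 → ℤ) (κ' : Fin 4) (u' : Fin 4 → ℤ),
      ∑ κ : Fin (3 + 1),
          ((1 / 2 : ℝ) * (vh2KerAt (toSite (ctrOff 4 Lc)) Lc m y (β, x) (κ, u - unitVec κ) (κ', u')
              + vh2KerAt (toSite (ctrOff 4 Lc)) Lc m y (β, x) (κ', u') (κ, u - unitVec κ))
            - (1 / 2 : ℝ) * (vh2KerAt (toSite (ctrOff 4 Lc)) Lc m y (β, x) (κ, u) (κ', u')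
              + vh2KerAt (toSite (ctrOff 4 Lc)) Lc m y (β, x) (κ', u') (κ, u))) =
        vhKerAt (toSite (ctrOff 4 Lc)) Lc m y (β, x) (κ', u')
          * ((if u = (Lc : ℤ) • y + toSite (ctrOff 4 Lc) then (1 : ℝ) else 0) - (if u = x then (1 : ℝ) else 0))) :
    ∀ (Y : Fin 4 → ℤ) (κ' : Fin 4) (u' x z : Fin 4 → ℤ) (β m : Fin 4), off Lc z = 0 →
      (stepScale 3 Lc 0 * (Lc : ℝ) ^ (3 + 1))⁻¹ *
          ∑ v ∈ box (3 + 1) Lc, ∑ κ : Fin (3 + 1),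
            ((-((Lc : ℝ) ^ 12 / 4)) * ((1 / 2 : ℝ) * (vh2KerAt (toSite (ctrOff 4 Lc)) Lc m (blk Lc z) (β, x) (κ, (Lc : ℤ) • Y + toSite v - unitVec κ) (κ', u')
                + vh2KerAt (toSite (ctrOff 4 Lc)) Lc m (blk Lc z) (β, x) (κ', u') (κ, (Lc : ℤ) • Y + toSite v - unitVec κ)))
              - (-((Lc : ℝ) ^ 12 / 4)) * ((1 / 2 : ℝ) * (vh2KerAt (toSite (ctrOff 4 Lc)) Lc m (blk Lc z) (β, x) (κ, (Lc : ℤ) • Y + toSite v) (κ', u')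
                + vh2KerAt (toSite (ctrOff 4 Lc)) Lc m (blk Lc z) (β, x) (κ', u') (κ, (Lc : ℤ) • Y + toSite v)))) =
        (-((Lc : ℝ) ^ (3 + 1) * (1 / 2) * (Lc : ℝ) ^ (3 + 1))) * vhKerAt (toSite (ctrOff 4 Lc)) Lc m (blk Lc z) (β, x) (κ', u')
            * ((1 / 2 : ℝ) * ∑ v ∈ box (3 + 1) Lc, (if z + toSite (ctrOff 4 Lc) = (Lc : ℤ) • Y + toSite v then (1 : ℝ) else 0))
          - ((1 / 2 : ℝ) * ∑ v ∈ box (3 + 1) Lc, (if x = (Lc : ℤ) • Y + toSite v then (1 : ℝ) else 0))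
            * ((-((Lc : ℝ) ^ (3 + 1) * (1 / 2) * (Lc : ℝ) ^ (3 + 1))) * vhKerAt (toSite (ctrOff 4 Lc)) Lc m (blk Lc z) (β, x) (κ', u')) := by
  intro Y κ' u' x z β m hz
  have hL : (Lc : ℝ) ≠ 0 := by exact_mod_cast NeZero.ne Lc
  have h0 : stepScale 3 Lc 0 = 1 := by simp [BorderedHessian.stepScale]
  -- on the coarse lattice the root of `b = (m, blk z)` is `z + ρ_c`
  have hzb : (Lc : ℤ) • blk Lc z = z := (eq_zsmul_blk_of_off hLc.pos hz).symm
  -- the inner `κ`-sum at each `v`, by the site law at `u := Lc•Y + v`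
  have hv : ∀ v ∈ box (3 + 1) Lc, ∑ κ : Fin (3 + 1),
      ((-((Lc : ℝ) ^ 12 / 4)) * ((1 / 2 : ℝ) * (vh2KerAt (toSite (ctrOff 4 Lc)) Lc m (blk Lc z) (β, x) (κ, (Lc : ℤ) • Y + toSite v - unitVec κ) (κ', u')
          + vh2KerAt (toSite (ctrOff 4 Lc)) Lc m (blk Lc z) (β, x) (κ', u') (κ, (Lc : ℤ) • Y + toSite v - unitVec κ)))
        - (-((Lc : ℝ) ^ 12 / 4)) * ((1 / 2 : ℝ) * (vh2KerAt (toSite (ctrOff 4 Lc)) Lc m (blk Lc z) (β, x) (κ, (Lc : ℤ) • Y + toSite v) (κ', u')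
          + vh2KerAt (toSite (ctrOff 4 Lc)) Lc m (blk Lc z) (β, x) (κ', u') (κ, (Lc : ℤ) • Y + toSite v)))) =
      (-((Lc : ℝ) ^ 12 / 4)) * (vhKerAt (toSite (ctrOff 4 Lc)) Lc m (blk Lc z) (β, x) (κ', u')
        * ((if z + toSite (ctrOff 4 Lc) = (Lc : ℤ) • Y + toSite v then (1 : ℝ) else 0) - (if x = (Lc : ℤ) • Y + toSite v then (1 : ℝ) else 0))) := by
    intro v _
    have h := hS ((Lc : ℤ) • Y + toSite v) m (blk Lc z) β x κ' u'
    rw [hzb] at h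
    have e : ∀ κ : Fin (3 + 1),
        (-((Lc : ℝ) ^ 12 / 4)) * ((1 / 2 : ℝ) * (vh2KerAt (toSite (ctrOff 4 Lc)) Lc m (blk Lc z) (β, x) (κ, (Lc : ℤ) • Y + toSite v - unitVec κ) (κ', u')
            + vh2KerAt (toSite (ctrOff 4 Lc)) Lc m (blk Lc z) (β, x) (κ', u') (κ, (Lc : ℤ) • Y + toSite v - unitVec κ)))
          - (-((Lc : ℝ) ^ 12 / 4)) * ((1 / 2 : ℝ) * (vh2KerAt (toSite (ctrOff 4 Lc)) Lc m (blk Lc z) (β, x) (κ, (Lc : ℤ) • Y + toSite v) (κ', u')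
            + vh2KerAt (toSite (ctrOff 4 Lc)) Lc m (blk Lc z) (β, x) (κ', u') (κ, (Lc : ℤ) • Y + toSite v))) =
        (-((Lc : ℝ) ^ 12 / 4)) * (((1 / 2 : ℝ) * (vh2KerAt (toSite (ctrOff 4 Lc)) Lc m (blk Lc z) (β, x) (κ, (Lc : ℤ) • Y + toSite v - unitVec κ) (κ', u')
            + vh2KerAt (toSite (ctrOff 4 Lc)) Lc m (blk Lc z) (β, x) (κ', u') (κ, (Lc : ℤ) • Y + toSite v - unitVec κ)))
          - (1 / 2 : ℝ) * (vh2KerAt (toSite (ctrOff 4 Lc)) Lc m (blk Lc z) (β, x) (κ, (Lc : ℤ) • Y + toSite v) (κ', u')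
            + vh2KerAt (toSite (ctrOff 4 Lc)) Lc m (blk Lc z) (β, x) (κ', u') (κ, (Lc : ℤ) • Y + toSite v))) := fun κ => by ring
    rw [Finset.sum_congr rfl (fun κ _ => e κ), ← Finset.mul_sum, h]
    -- orientation of the two indicator tests
    have e1 : (if (Lc : ℤ) • Y + toSite v = z + toSite (ctrOff 4 Lc) then (1 : ℝ) else 0) =
        (if z + toSite (ctrOff 4 Lc) = (Lc : ℤ) • Y + toSite v then (1 : ℝ) else 0) := by
      by_cases h' : z + toSite (ctrOff 4 Lc) = (Lc : ℤ) • Y + toSite v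
      · rw [if_pos h', if_pos h'.symm]
      · rw [if_neg h', if_neg (fun h'' => h' h''.symm)]
    have e2 : (if (Lc : ℤ) • Y + toSite v = x then (1 : ℝ) else 0) = (if x = (Lc : ℤ) • Y + toSite v then (1 : ℝ) else 0) := by
      by_cases h' : x = (Lc : ℤ) • Y + toSite v
      · rw [if_pos h', if_pos h'.symm]
      · rw [if_neg h', if_neg (fun h'' => h' h''.symm)]
    rw [e1, e2]
  rw [Finset.sum_congr rfl hv, ← Finset.mul_sum, h0]
  simp only [mul_sub, Finset.sum_sub_distrib, ← Finset.mul_sum]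
  field_simp
  ring

/-- [folklore] **(W2-M) ⟹ THE MIXED WARD BOND IDENTITY (WM-bond) AT THE Λ-LOCK** `cΛ = 2∕Lc⁴` (the row owner's K-W1 hypothesis `hWM`, token for
token): in the f↔f′-symmetrisation the ROOT indicators cancel (`hessKerAt_swap`) and the two row-leg indicators survive. -/
theorem bondWardM_of_siteWardM
    (hS : ∀ (u : Fin 4 → ℤ) (ρ' : Fin 4) (w : Fin 4 → ℤ) (β : Fin 4) (x : Fin 4 → ℤ) (β' : Fin 4) (x' : Fin 4 → ℤ),
      ∑ κ : Fin (3 + 1),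
          (mixKerAt (toSite (ctrOff 4 Lc)) Lc ρ' w (κ, u - unitVec κ) (β, x) (β', x')
            - mixKerAt (toSite (ctrOff 4 Lc)) Lc ρ' w (κ, u) (β, x) (β', x')) =
        2 * hessKerAt (toSite (ctrOff 4 Lc)) Lc ρ' w (β, x) (β', x')
          * ((if u = (Lc : ℤ) • w + toSite (ctrOff 4 Lc) then (1 : ℝ) else 0) - (if u = x then (1 : ℝ) else 0))) :
    ∀ (y : Fin (3 + 1) → ℤ) (ρ' : Fin (3 + 1)) (w : Fin (3 + 1) → ℤ) (β : Fin (3 + 1)) (x : Fin (3 + 1) → ℤ) (β' : Fin (3 + 1))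
      (x' : Fin (3 + 1) → ℤ),
      ((Lc : ℝ) ^ (3 + 1))⁻¹ * (∑ v ∈ box (3 + 1) Lc, ∑ κ : Fin (3 + 1),
          ((mixKerAt (toSite (ctrOff 4 Lc)) Lc ρ' w (κ, (Lc : ℤ) • y + toSite v - unitVec κ) (β, x) (β', x')
              - mixKerAt (toSite (ctrOff 4 Lc)) Lc ρ' w (κ, (Lc : ℤ) • y + toSite v) (β, x) (β', x'))
            + (mixKerAt (toSite (ctrOff 4 Lc)) Lc ρ' w (κ, (Lc : ℤ) • y + toSite v - unitVec κ) (β', x') (β, x)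
              - mixKerAt (toSite (ctrOff 4 Lc)) Lc ρ' w (κ, (Lc : ℤ) • y + toSite v) (β', x') (β, x)))) =
        2 * ((2 / (Lc : ℝ) ^ 4) * hessKerAt (toSite (ctrOff 4 Lc)) Lc ρ' w (β, x) (β', x') *
          ((1 / 2 : ℝ) * (∑ v ∈ box (3 + 1) Lc, (if x' = (Lc : ℤ) • y + toSite v then (1 : ℝ) else 0))
            - (1 / 2 : ℝ) * (∑ v ∈ box (3 + 1) Lc, (if x = (Lc : ℤ) • y + toSite v then (1 : ℝ) else 0)))) := by
  intro y ρ' w β x β' x'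
  have hL : (Lc : ℝ) ≠ 0 := by exact_mod_cast NeZero.ne Lc
  have hsw := hessKerAt_swap (toSite (ctrOff 4 Lc)) Lc ρ' w (β, x) (β', x')
  have hv : ∀ v ∈ box (3 + 1) Lc, ∑ κ : Fin (3 + 1),
      ((mixKerAt (toSite (ctrOff 4 Lc)) Lc ρ' w (κ, (Lc : ℤ) • y + toSite v - unitVec κ) (β, x) (β', x')
          - mixKerAt (toSite (ctrOff 4 Lc)) Lc ρ' w (κ, (Lc : ℤ) • y + toSite v) (β, x) (β', x'))
        + (mixKerAt (toSite (ctrOff 4 Lc)) Lc ρ' w (κ, (Lc : ℤ) • y + toSite v - unitVec κ) (β', x') (β, x)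
          - mixKerAt (toSite (ctrOff 4 Lc)) Lc ρ' w (κ, (Lc : ℤ) • y + toSite v) (β', x') (β, x))) =
      2 * hessKerAt (toSite (ctrOff 4 Lc)) Lc ρ' w (β, x) (β', x')
        * ((if x' = (Lc : ℤ) • y + toSite v then (1 : ℝ) else 0) - (if x = (Lc : ℤ) • y + toSite v then (1 : ℝ) else 0)) := by
    intro v _
    rw [Finset.sum_add_distrib, hS ((Lc : ℤ) • y + toSite v) ρ' w β x β' x', hS ((Lc : ℤ) • y + toSite v) ρ' w β' x' β x, hsw]
    have e2 : (if (Lc : ℤ) • y + toSite v = x then (1 : ℝ) else 0) = (if x = (Lc : ℤ) • y + toSite v then (1 : ℝ) else 0) := by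
      by_cases h' : x = (Lc : ℤ) • y + toSite v
      · rw [if_pos h', if_pos h'.symm]
      · rw [if_neg h', if_neg (fun h'' => h' h''.symm)]
    have e3 : (if (Lc : ℤ) • y + toSite v = x' then (1 : ℝ) else 0) = (if x' = (Lc : ℤ) • y + toSite v then (1 : ℝ) else 0) := by
      by_cases h' : x' = (Lc : ℤ) • y + toSite v
      · rw [if_pos h', if_pos h'.symm]
      · rw [if_neg h', if_neg (fun h'' => h' h''.symm)]
    rw [e2, e3]
    ring
  rw [Finset.sum_congr rfl hv]
  simp only [mul_sub, Finset.sum_sub_distrib, ← Finset.mul_sum]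
  field_simp
  ring

open Classical in
/-- [folklore] **hW ∧ hR FOR THE PINNED LITERAL FROM THE TWO REFLECTION BOND LAWS AND an1's TWO SITE-LEVEL WARD LAWS** (all four
HYPOTHESES): RX's `symmetries_JsRowD1Pin_of_bondLaws` with `hWb := bondWardB_of_siteWardB …`, `hWM := bondWardM_of_siteWardM …`. -/
theorem symmetries_JsRowD1Pin_of_siteLaws (hLc : Odd Lc) {N : ℕ} (hN : 2 ≤ N) (γ : ℕ → ℝ)
    (hγ : ∀ j, γ j = -((Lc : ℝ) ^ 8 / 2) * wVH 3 Lc j / (stepScale 3 Lc j * (Lc : ℝ) ^ 4))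
    (hMb : ∀ (α κ : Fin 4) (u : Fin 4 → ℤ) (ρ' : Fin 4) (w : Fin 4 → ℤ) (β : Fin 4) (x : Fin 4 → ℤ) (β' : Fin 4) (z : Fin 4 → ℤ),
      mixKerAt (toSite (ctrOff 4 Lc)) Lc ρ' (bref α ρ' w) (κ, bref α κ u) (β, x) (β', z)
        = reflSign α κ * reflSign α ρ' * (reflSign α β * reflSign α β' *
            (mixKerAt (toSite (ctrOff 4 Lc)) Lc ρ' w (κ, u) (β, bref α β x) (β', bref α β' z)
              + 2 * (if bref α β x = u ∧ β = κ ∧ κ = α then -1 else 0)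
                  * hessKerAt (toSite (ctrOff 4 Lc)) Lc ρ' w (β, bref α β x) (β', bref α β' z)
              + 2 * (if ρ' = α then linKerAt (toSite (ctrOff 4 Lc)) Lc ρ' w (κ, u) else 0)
                  * hessKerAt (toSite (ctrOff 4 Lc)) Lc ρ' w (β, bref α β x) (β', bref α β' z))))
    (hBb : ∀ (α m : Fin 4) (y : Fin 4 → ℤ) (β : Fin 4) (x : Fin 4 → ℤ) (κ : Fin 4) (u : Fin 4 → ℤ) (κ' : Fin 4) (u' : Fin 4 → ℤ),
      reflSign α β * reflSign α κ * reflSign α κ' * reflSign α m *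
          (vh2KerAt (toSite (ctrOff 4 Lc)) Lc m (bref α m y) (β, bref α β x) (κ, bref α κ u) (κ', bref α κ' u')
            + vh2KerAt (toSite (ctrOff 4 Lc)) Lc m (bref α m y) (β, bref α β x) (κ', bref α κ' u') (κ, bref α κ u))
        = (vh2KerAt (toSite (ctrOff 4 Lc)) Lc m y (β, x) (κ, u) (κ', u') + vh2KerAt (toSite (ctrOff 4 Lc)) Lc m y (β, x) (κ', u') (κ, u))
          + 2 * (vhKerAt (toSite (ctrOff 4 Lc)) Lc m y (β, x) (κ', u')
                  * ((if m = α then linKerAt (toSite (ctrOff 4 Lc)) Lc m y (κ, u) else 0) - (if x = u ∧ β = κ ∧ κ = α then 1 else 0))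
                + vhKerAt (toSite (ctrOff 4 Lc)) Lc m y (β, x) (κ, u)
                  * ((if m = α then linKerAt (toSite (ctrOff 4 Lc)) Lc m y (κ', u') else 0) - (if x = u' ∧ β = κ' ∧ κ' = α then 1 else 0))
                + linKerAt (toSite (ctrOff 4 Lc)) Lc m y (β, x)
                  * ((if m = α then linKerAt (toSite (ctrOff 4 Lc)) Lc m y (κ, u) else 0) - (if x = u ∧ β = κ ∧ κ = α then 1 else 0))
                  * ((if m = α then linKerAt (toSite (ctrOff 4 Lc)) Lc m y (κ', u') else 0) - (if x = u' ∧ β = κ' ∧ κ' = α then 1 else 0))))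
    (hSB : ∀ (u : Fin 4 → ℤ) (m : Fin 4) (y : Fin 4 → ℤ) (β : Fin 4) (x : Fin 4 → ℤ) (κ' : Fin 4) (u' : Fin 4 → ℤ),
      ∑ κ : Fin (3 + 1),
          ((1 / 2 : ℝ) * (vh2KerAt (toSite (ctrOff 4 Lc)) Lc m y (β, x) (κ, u - unitVec κ) (κ', u')
              + vh2KerAt (toSite (ctrOff 4 Lc)) Lc m y (β, x) (κ', u') (κ, u - unitVec κ))
            - (1 / 2 : ℝ) * (vh2KerAt (toSite (ctrOff 4 Lc)) Lc m y (β, x) (κ, u) (κ', u')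
              + vh2KerAt (toSite (ctrOff 4 Lc)) Lc m y (β, x) (κ', u') (κ, u))) =
        vhKerAt (toSite (ctrOff 4 Lc)) Lc m y (β, x) (κ', u')
          * ((if u = (Lc : ℤ) • y + toSite (ctrOff 4 Lc) then (1 : ℝ) else 0) - (if u = x then (1 : ℝ) else 0)))
    (hSM : ∀ (u : Fin 4 → ℤ) (ρ' : Fin 4) (w : Fin 4 → ℤ) (β : Fin 4) (x : Fin 4 → ℤ) (β' : Fin 4) (x' : Fin 4 → ℤ),
      ∑ κ : Fin (3 + 1),
          (mixKerAt (toSite (ctrOff 4 Lc)) Lc ρ' w (κ, u - unitVec κ) (β, x) (β', x')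
            - mixKerAt (toSite (ctrOff 4 Lc)) Lc ρ' w (κ, u) (β, x) (β', x')) =
        2 * hessKerAt (toSite (ctrOff 4 Lc)) Lc ρ' w (β, x) (β', x')
          * ((if u = (Lc : ℤ) • w + toSite (ctrOff 4 Lc) then (1 : ℝ) else 0) - (if u = x then (1 : ℝ) else 0))) :
    (∀ j : ℕ, WardTransversal (flipK (TbalOf Lc (JsRowD1Pin hLc N) j)))
      ∧ (∀ j : ℕ, AxisReflectionCovariant (flipK (TbalOf Lc (JsRowD1Pin hLc N) j))) :=
  symmetries_JsRowD1Pin_of_bondLaws hLc hN γ hγ hMb hBb (bondWardB_of_siteWardB hLc hSB) (bondWardM_of_siteWardM hSM)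

end

end Summit.QuantumFields.BalabanUV.Beta.WardSiteToBlock
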